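import Summits.SmoothPoincare4.SmoothPoincare4.Theses.EntropyRung
import Summits.SmoothPoincare4.SmoothPoincare4.Theorems.SubcylindricalExistence.Negative.Window
import Summits.SmoothPoincare4.SmoothPoincare4.Theorems.SubcylindricalExistence.Negative.Logic
import Summits.SmoothPoincare4.SmoothPoincare4.Theorems.EntropyRungSubcylindricalExistenceDimensionalFisher
import Summits.SmoothPoincare4.SmoothPoincare4.Theorems.EntropyRungSubcylindricalExistenceEntropyEnergyAlongFlow
import Summits.SmoothPoincare4.SmoothPoincare4.Theorems.EntropyRungSubcylindricalExistenceEntropyEnergyPositive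
import Summits.SmoothPoincare4.SmoothPoincare4.Theorems.EntropyRungSubcylindricalExistenceEntropyEnergyOfPositive
import Summits.SmoothPoincare4.SmoothPoincare4.Theorems.EntropyRungSubcylindricalExistenceEntropyVolume
import HarnessLib

/-!
# Line `ekeland-stable-shrinker` for crux `EntropyRung.SubcylindricalExistence`
# (stmt-SmoothPoincare4-10871, "ENT")

Route `EntropyRung`, crux r5 `SubcylindricalExistence` = every closed smooth `M ≃ₕ S⁴` carries a
Riemannian metric `g` (with Levi-Civita connection) with `R > 0` and `ν(g) > ν_cyl`, typed
fact-free: `∃ δ > 0, ∀ τ > 0, ∀ f` smooth with `∫ (4πτ)⁻² e^{-f} dV = 1`,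
`ν_cyl + δ ≤ 𝒲(g,f,τ) = ∫ [τ(R + |∇f|²) + f − 4](4πτ)⁻² e^{-f} dV`, `ν_cyl = log 2 + ½ log π − 3/2`.

## The line (crux idea card `ekeland-stable-shrinker`, ideator 3; triage r1: 3 × pass, with the
## sharpenings "K2 for SMOOTH shrinkers, first Lean stub", "K1 UNGUARDED", "orbifold bubbles are
## K1's bookkeeping")

LEVER. Read the crux as the statement `ν(Σ) > ν_cyl` about the smooth invariant
`ν(Σ) := sup {ν(g) : g Riemannian on Σ, R_g > 0}` (`ν(g) = inf_τ μ(g,τ)`), and exploit its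
EXTREMAL STRUCTURE instead of constructing a metric:
* a maximiser of `ν` over the flow-invariant open cone `{R > 0}` is a GRADIENT SHRINKING SOLITON —
  run the Ricci flow from it: `ν` cannot increase, so Perelman's monotonicity formula is an
  equality, `Ric + ∇²f = g/2τ` (Statement S below, the card's First lemma, triage-verified);
* a maximiser is a (global, hence local) maximum of `ν`, i.e. `ν`-STABLE with all higher
  variations signed; on a homotopy 4-sphere `b₂ = 0` removes every known destabilising direction
  and every known non-round compact shrinker, and the `b₂ = 0` corner of Hamilton's Conjecture 1 /
  Cao's Conjecture 2 (Cao–Zhu arXiv:2304.01453 p. 9) says such a maximiser is the ROUND `S⁴`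
  (Statement R below = K2 of the card, in Bishop form: normalised to `Vol = 8π²/3` it has
  `Ric ≥ 3g`, equivalently is isometric to `S⁴(1)`, and its carrier is diffeomorphic to `S⁴`);
* the non-attained case is Palais–Smale compactness MODULO NECKS (and entropy-scale bubbles) for
  `ν` on `{R > 0}` (K1 of the card); its typeable OUTPUT is Statement A below: the entropy level
  `ν(Σ)` of every homotopy 4-sphere `Σ` is reached from above by an ATTAINED level — some homotopy
  4-sphere `N` (Σ itself if no neck forms, a capped neck-piece otherwise) carries a PSC
  `ν`-maximiser `g_N` with `ν(g_N) ≤ ν(Σ)` (spelled as: every entropy floor of `g_N`, lowered by any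
  `ε > 0`, is the floor of some PSC metric on `Σ`);
* the round value: `Ric ≥ 3g`, `Vol = 8π²/3` ⇒ `μ(g,τ) ≥ log 6 − 2 = ν_rd` for every `τ`
  (RoundBound) — PROVED in this file from the tree's Theorem A chain
  (`Theorems.stub_entropyVolume_of_entropyEnergy` ∘ `stub_entropyEnergy_of_positive` ∘
  `stub_entropyEnergy_positive` ∘ `stub_entropyEnergy_alongFlow` ∘ `stub_dimensionalFisher`, all
  landed 2026-08-16) modulo the one remaining library apex `StaticLinearHeat` (Statement H), which
  this line therefore SHARES verbatim with line `curvature-dimension-entropy-floor`.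

COMPOSITION (`SubcylindricalExistence_of`, kernel-checked, no `sorry`): given `M ≃ₕ S⁴`, Statement A
gives `(N, g_N)`; S makes `g_N` a shrinker; R gives `Ric ≥ 3 g_N`; RoundBound (from H) gives the
floor `log 6 − 2` for `g_N`; A's approximation clause with `ε := (ν_rd − ν_cyl)/2 > 0`
(`Negative.nuCyl_lt_nuRound`, landed) transports the floor `ν_rd − ε = ν_cyl + ε` to a PSC metric
on `M`: that is ENT with `δ = ε ≈ 0.0131`.

CUT into four stubs (each a genuine statement of the line; the open difficulty is NAMED; they are
spelled for registration but were deliberately NOT pushed into the crux's stub registry by the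
planner — `ledger skeleton check` replaces the active set and the picked line is mid-build; the
same `#h21_check_skeleton` audit was run by hand, verdict in the line card):
* `stub_maximiserIsShrinker` (S, size L): Perelman's monotonicity with its equality case, short-time
  existence keeping `R > 0`, Rothaus minimisers — none in the library (`perelman_muEntropy_monotone`
  is a named `Prop`, unproved).
* `stub_maximiserRigidity` (R = K2-smooth, OPEN, theorem-shaped): `b₂ = 0` corner of the
  Hamilton–Cao `ν`-stability conjectures in GLOBAL-max form (weaker than the local-max form);
  Einstein sub-case = Hitchin + Gursky + maximality; on `S⁴` it predicts UNIQUENESS of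
  `ν`-maximisers among PSC metrics (open even there; Kröncke: round `S⁴` is a local max).
* `stub_compactnessModNecks` (A = K1-output, OPEN, HARDEST, no literature): the concentration-
  compactness statement; on `S⁴` it predicts that `sup {ν(g) : R_g > 0}` is ATTAINED (by the round
  metric, if R holds). Its branch "all neck-pieces super-cylindrical" is contradictory only through
  recognition of the pieces (this line's S + R applied to each piece, or the sibling crux RUNG) —
  recorded in the line card; the registered statement is unconditional.
* `stub_staticLinearHeat` (H, size L, library apex shared with the picked line and with
  `carrilloNi_muEntropy_eq_log_shrinkerDensity_of_staticLinearHeat`).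

## Disproof used

`payload.disproof_path` (cdisprove `Disproof.lean` v6) is not mounted in planner jails and
`Cruxes/SubcylindricalExistence/Disproof.lean` is not published (`ledger crux ls`); known through its
item-evidence notes v1–v6 and its LANDED `Theorems/SubcylindricalExistence/Negative/*`:
* `Negative.subcylindricalExistence_iff_spc4` (Logic.lean: ENT ⇔ SPC4 modulo RUNG + transported round
  witness) — HONOURED: all SPC4-hardness sits in the two named open stubs R and A; the line never
  pretends to build a metric on an unknown `Σ` (barrier note B1 of the card: every glued metric has
  `ν ≤ ν_cyl + o(1)`), it reads off the maximiser.
* `Negative.nuCyl_lt_nuRound` / `margin_gt` / `margin_lt` (Window.lean) — USED: `ε = (ν_rd − ν_cyl)/2`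
  is positive by `nuCyl_lt_nuRound`; the line's `δ_ENT = ε ∈ (0.013, 0.01315)`.
* `Negative.constClause_iff` / `subcylindricalWitness_totalScalar_sq` (ConstTest.lean) — CONSISTENT:
  the witness produced on `M` is only known through its entropy floor; on `N` the maximiser has
  `Ric ≥ 3`, `Vol = 8π²/3`, so `(∫R)² ≥ 144 Vol² = e^{ν_rd+2}·64π²·Vol`, the constant-test boundary
  with equality (round metric), as it must be.
* `Negative.nuSheet_lt_nuCyl`, neck/sheet profiles — these are exactly the degenerations Statement A
  quotients out (necks pin `ν ≤ ν_cyl`, sheets `≤ ν_bs`); A is stated on the far side of them.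
* Disproof v5 `RoundOptimality` variant (open; Kröncke arXiv:1403.3721 Thm 6.5/Rem 3.8: round `S⁴` is
  a LOCAL maximiser of `ν`) — Statement R restricted to `N = S⁴` is the matching global UNIQUENESS
  statement, Statement A restricted to `S⁴` the matching ATTAINMENT statement; neither is refuted.
* `ledger negatives --problem SmoothPoincare4`: nothing on this crux's statements; no stub is an
  instance of a refuted statement (R and A are strictly stronger than ENT only jointly, and neither
  restates ENT, the summit, or the ∀-PSC strengthening refuted in Disproof v4 §5).
-/

noncomputable section

-- the crux-folder namespace repeats the summit component (`Summit.SmoothPoincare4.SmoothPoincare4.…`)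
set_option linter.dupNamespace false

open scoped Manifold ContDiff Topology ENNReal NNReal ContinuousMap
open Set MeasureTheory
open Literature.Geometry.Lorentzian Literature.Geometry.Riemannian

namespace Summit.SmoothPoincare4.SmoothPoincare4.Cruxes.SubcylindricalExistence.EkelandStableShrinker

/-! ## Vocabulary (readable abbreviations; the registered stubs below are spelled WITHOUT them, over
tree declarations only, so that `--supports` proofs can restate them verbatim) -/

/-- **Entropy floor** `c ≤ μ(g,τ)` for all `τ > 0`, i.e. `ν(g) ≥ c`, in the crux's fact-free
spelling: for every `τ > 0` and every smooth `f` with `∫ (4πτ)⁻² e^{-f} dV = 1`,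
`c ≤ 𝒲(g,f,τ) = ∫ [τ(R + |∇f|²) + f − 4] (4πτ)⁻² e^{-f} dV`. The crux `SubcylindricalExistence`
reads `∃ g …, R > 0 ∧ ∃ δ > 0, EntropyFloor M g hg (ν_cyl + δ)`. [folklore] -/
def EntropyFloor (M : Type) [TopologicalSpace M] [T2Space M] [SecondCountableTopology M]
    [ChartedSpace (EuclideanSpace ℝ (Fin 4)) M] [IsManifold (𝓡 4) ∞ M] [CompactSpace M] [T3Space M]
    [MeasurableSpace M] [BorelSpace M]
    (g : PseudoRiemannianMetric (𝓡 4) ∞ (EuclideanSpace ℝ (Fin 4)) (TangentSpace (𝓡 4) : M → Type _))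
    [g.HasLeviCivita] (hg : g.IsRiemannian) (c : ℝ) : Prop :=
  ∀ τ : ℝ, 0 < τ → ∀ f : M → ℝ, ContMDiff (𝓡 4) 𝓘(ℝ, ℝ) ∞ f →
    ∫ x, (4 * Real.pi * τ) ^ (-(4 : ℝ) / 2) * Real.exp (-f x)
        ∂(riemannianMeasure (g.toContMDiffRiemannianMetric hg)) = 1 →
    c ≤ ∫ x, (τ * (g.scalarCurvature x + g.gradSq f x) + f x - 4) *
        ((4 * Real.pi * τ) ^ (-(4 : ℝ) / 2) * Real.exp (-f x))
        ∂(riemannianMeasure (g.toContMDiffRiemannianMetric hg))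

/-- **PSC `ν`-maximiser**: `g` has `R > 0` and `ν(g) = ν(M) := sup {ν(g₂) : R_{g₂} > 0}`, spelled as
"every entropy floor of every PSC competitor `g₂` (with Levi-Civita connection) is a floor of `g`".
The hypothesis of the card's First lemma `MaximiserIsShrinker`. [folklore] -/
def IsPscMaximiser (M : Type) [TopologicalSpace M] [T2Space M] [SecondCountableTopology M]
    [ChartedSpace (EuclideanSpace ℝ (Fin 4)) M] [IsManifold (𝓡 4) ∞ M] [CompactSpace M] [T3Space M]
    [MeasurableSpace M] [BorelSpace M]
    (g : PseudoRiemannianMetric (𝓡 4) ∞ (EuclideanSpace ℝ (Fin 4)) (TangentSpace (𝓡 4) : M → Type _))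
    [g.HasLeviCivita] (hg : g.IsRiemannian) : Prop :=
  (∀ x : M, 0 < g.scalarCurvature x) ∧
    ∀ (g₂ : PseudoRiemannianMetric (𝓡 4) ∞ (EuclideanSpace ℝ (Fin 4)) (TangentSpace (𝓡 4) : M → Type _))
      [g₂.HasLeviCivita] (hg₂ : g₂.IsRiemannian), (∀ x : M, 0 < g₂.scalarCurvature x) →
      ∀ c : ℝ, EntropyFloor M g₂ hg₂ c → EntropyFloor M g hg c

/-! ## The four statements of the line (named; the registered stubs restate them verbatim) -/

/-- **Statement S — a PSC `ν`-maximiser is a gradient shrinking soliton** (card: First lemma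
`MaximiserIsShrinker`; CHI arXiv:math/0404165 §2 first variation; here via the flow): on a closed
4-manifold of the summit binder, if `g` (Riemannian, with Levi-Civita connection, `R > 0`) maximises
`ν` among PSC metrics, then `Ric_g + ∇²f = g/(2τ)` for some `τ > 0` and smooth `f`. Proof plan: Ricci
flow `g(t)` from `g` exists for short time and keeps `R > 0` (maximum principle; flow vocabulary in
tree); maximality gives `ν(g(t₁)) ≤ ν(g)`; `ν(g(t₁)) = μ(g(t₁), τ₁)` is attained (`R > 0` ⇒
`μ → +∞` as `τ → ∞`, `μ → 0` as `τ → 0`, and `ν(g(t₁))` is realised by a pair `(f₁, τ₁)` on compact `M` — CHI 2004 §2;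
Rothaus minimiser at fixed `τ`); Perelman's
monotonicity `μ(g, τ₁ + t₁) ≤ μ(g(t₁), τ₁)` (Perelman 2002 §3.1 (3.4) = hypothesis (T2) of
`PerelmanEntropyNoncollapsing.lean`, named `Prop` `perelman_muEntropy_monotone`, unproved) closes the
chain `ν(g) ≤ μ(g, τ₁+t₁) ≤ ν(g(t₁)) ≤ ν(g)`, so `∫₀^{t₁} 2τ ∫ |Ric + ∇²f − g/2τ|² u dV dt = 0`: the
soliton equation at `t = 0` with `τ = τ₁ + t₁`. -/
def MaximiserIsShrinker : Prop :=
  ∀ (M : Type) [TopologicalSpace M] [T2Space M] [SecondCountableTopology M]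
    [ChartedSpace (EuclideanSpace ℝ (Fin 4)) M] [IsManifold (𝓡 4) ∞ M] [CompactSpace M] [T3Space M]
    [MeasurableSpace M] [BorelSpace M]
    (g : PseudoRiemannianMetric (𝓡 4) ∞ (EuclideanSpace ℝ (Fin 4)) (TangentSpace (𝓡 4) : M → Type _))
    [g.HasLeviCivita] (hg : g.IsRiemannian),
    IsPscMaximiser M g hg →
    ∃ τ : ℝ, 0 < τ ∧ ∃ f : M → ℝ, ContMDiff (𝓡 4) 𝓘(ℝ, ℝ) ∞ f ∧
      ∀ (x : M) (X Y : TangentSpace (𝓡 4) x),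
        g.ricci x X Y + g.hessian f x X Y = (1 / (2 * τ)) * g.val x X Y

/-- **Statement R — rigidity of `ν`-maximising compact shrinkers on homotopy 4-spheres** (K2 of the
card for SMOOTH shrinkers, triage sharpening; the `b₂ = 0` corner of Hamilton's Conjecture 1 (2004) and
Cao's Conjecture 2 (2006), Cao–Zhu arXiv:2304.01453 p. 9, in GLOBAL-max form): a closed `M ≃ₕ S⁴`
with a gradient shrinking soliton `(g, f, τ)` whose metric maximises `ν` among PSC metrics on `M`,
normalised to `Vol(M, g) = 8π²/3 = Vol S⁴(1)`, has `Ric ≥ 3g` — by Bishop's volume rigidity this says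
exactly that `(M, g)` is isometric to the unit round sphere — and `M` is diffeomorphic to `S⁴`.
Einstein sub-case (`f` constant): Hitchin 1974 + Gursky 2000 give round or `Θ ≤ 2/e² = .271`; CHI
Thm 2.1 / Ex. 2.2 (round `Sⁿ` is `ν`-stable, `μ_N = −2/((n−1)τ)`), Cao–Zhu 2012 (second variation
operator `N_f` at a general compact shrinker), Cao–Zhu 2024 Thm 1.1–1.2 (necessary conditions for
`ν`-stability); every known compact non-round 4-d shrinker lives on `ℂP² # k(−ℂP²)` or `S² × S²`
(`b₂ ≥ 1`). On `S⁴` itself the statement is the UNIQUENESS of `ν`-maximisers among PSC metrics. -/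
def MaximiserRigidity : Prop :=
  ∀ (M : Type) [TopologicalSpace M] [T2Space M] [SecondCountableTopology M]
    [ChartedSpace (EuclideanSpace ℝ (Fin 4)) M] [IsManifold (𝓡 4) ∞ M] [CompactSpace M] [T3Space M]
    [MeasurableSpace M] [BorelSpace M],
    M ≃ₕ Metric.sphere (0 : EuclideanSpace ℝ (Fin 5)) 1 →
    ∀ (g : PseudoRiemannianMetric (𝓡 4) ∞ (EuclideanSpace ℝ (Fin 4)) (TangentSpace (𝓡 4) : M → Type _))
      [g.HasLeviCivita] (hg : g.IsRiemannian) (f : M → ℝ) (τ : ℝ), 0 < τ →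
      ContMDiff (𝓡 4) 𝓘(ℝ, ℝ) ∞ f →
      (∀ (x : M) (X Y : TangentSpace (𝓡 4) x),
        g.ricci x X Y + g.hessian f x X Y = (1 / (2 * τ)) * g.val x X Y) →
      IsPscMaximiser M g hg →
      (riemannianMeasure (g.toContMDiffRiemannianMetric hg) Set.univ).toReal = 8 * Real.pi ^ 2 / 3 →
      (∀ (x : M) (v : TangentSpace (𝓡 4) x), 3 * g.val x v v ≤ g.ricci x v v) ∧
        Nonempty (M ≃ₘ⟮𝓡 4, 𝓡 4⟯ Metric.sphere (0 : EuclideanSpace ℝ (Fin 5)) 1)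

/-- **Statement A — the entropy level of a homotopy 4-sphere is reached by an ATTAINED level**
(typeable output of K1 = "Palais–Smale compactness modulo necks and entropy-scale bubbles for `ν` on
`{R > 0}`", triage sharpening "unguarded"): for every closed `M ≃ₕ S⁴` there are a closed
`N ≃ₕ S⁴` (summit binder) and a PSC `ν`-maximiser `g_N` on `N`, normalised to `Vol = 8π²/3`, such
that for every `ε > 0` some PSC metric `h` on `M` (with Levi-Civita connection) satisfies
`ν(h) ≥ ν(g_N) − ε`, floor by floor. Informally `ν(N) = ν(g_N) ≤ ν(M)` with `ν(N)` attained; on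
`M = S⁴` it says `sup {ν(g) : R_g > 0 on S⁴}` is attained (by the round metric, given R). Proof plan
(card K1 + regluing): take PSC `g_i` on `M` with `ν(g_i) → ν(M)`; (a) if `ν(M) > ν_cyl` no neck can
form at the entropy scale and the flows of the `g_i` (space-time weighted-`L²` almost-solitons,
`∫₀^T 2τ∫|Ric + ∇²f − g/2τ|²u ≤ ν(M) − ν(g_i)`) subconverge to a compact shrinker ON `M`: `N = M`;
(b) if `ν(M) ≤ ν_cyl`, cut the `ε_i`-necks: some capped piece is BAD (`ν ≤ ν(M) + o(1)`) and
subconverges to a compact shrinker `g_N` on a piece `N ≃ₕ S⁴` with `ν(g_N) = ν(M)`, maximal on `N`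
(else re-gluing better metrics on the pieces through long necks beats the sup), or (c) every piece is
eventually super-cylindrical — contradictory only through RECOGNITION of the pieces (this line's
S + R on each piece via (a), or the sibling crux RUNG: pieces `≅ S⁴` ⇒ `M ≅ S⁴` ⇒ `ν(M) ≥ ν_rd`).
Orbifold (`ℝ⁴/Γ`) bubbles need Ricci-flat ALE pieces `W ⊂ M` with `H₂(W;ℤ) = 0` and `S³/Γ ↪ M`
(none known; local density `≤ 1/|Γ| ≤ ½ < e^{ν}` whenever `ν(M) > −log 2`). -/
def EntropySupAttained : Prop :=
  ∀ (M : Type) [TopologicalSpace M] [T2Space M] [SecondCountableTopology M]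
    [ChartedSpace (EuclideanSpace ℝ (Fin 4)) M] [IsManifold (𝓡 4) ∞ M] [CompactSpace M] [T3Space M]
    [MeasurableSpace M] [BorelSpace M],
    M ≃ₕ Metric.sphere (0 : EuclideanSpace ℝ (Fin 5)) 1 →
    ∃ (N : Type) (_ : TopologicalSpace N) (_ : T2Space N) (_ : SecondCountableTopology N)
      (_ : ChartedSpace (EuclideanSpace ℝ (Fin 4)) N) (_ : IsManifold (𝓡 4) ∞ N) (_ : CompactSpace N)
      (_ : T3Space N) (_ : MeasurableSpace N) (_ : BorelSpace N)
      (_ : N ≃ₕ Metric.sphere (0 : EuclideanSpace ℝ (Fin 5)) 1)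
      (g : PseudoRiemannianMetric (𝓡 4) ∞ (EuclideanSpace ℝ (Fin 4)) (TangentSpace (𝓡 4) : N → Type _))
      (_ : g.HasLeviCivita) (hg : g.IsRiemannian),
      IsPscMaximiser N g hg ∧
      (riemannianMeasure (g.toContMDiffRiemannianMetric hg) Set.univ).toReal = 8 * Real.pi ^ 2 / 3 ∧
      ∀ ε : ℝ, 0 < ε →
        ∃ (h : PseudoRiemannianMetric (𝓡 4) ∞ (EuclideanSpace ℝ (Fin 4)) (TangentSpace (𝓡 4) : M → Type _))
          (_ : h.HasLeviCivita) (hh : h.IsRiemannian),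
          (∀ x : M, 0 < h.scalarCurvature x) ∧
            ∀ c : ℝ, EntropyFloor N g hg c → EntropyFloor M h hh (c - ε)

/-- **Statement H — the static linear heat-type Cauchy problem on closed connected Riemannian
4-manifolds** (VERBATIM Statement A / `stub_staticLinearHeat` of line `curvature-dimension-entropy-floor`
and the hypothesis `hLPs` of `carrilloNi_muEntropy_eq_log_shrinkerDensity_of_staticLinearHeat`):
`∂ₛw = Δ_g w − Q w`, `w(0) = w₀`, smooth on `M × [0, T]`. Friedman 1964 Ch. 1 Thm 10 / Ch. 3 Thm 7;
Topping 2006 Rem. 8.2.5. It is the only open input of RoundBound (below). -/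
def StaticLinearHeat : Prop :=
  ∀ (M : Type) [TopologicalSpace M] [T2Space M] [SecondCountableTopology M]
    [ChartedSpace (EuclideanSpace ℝ (Fin 4)) M] [IsManifold (𝓡 4) ∞ M] [CompactSpace M] [T3Space M]
    [MeasurableSpace M] [BorelSpace M] [ConnectedSpace M]
    (g : PseudoRiemannianMetric (𝓡 4) ∞ (EuclideanSpace ℝ (Fin 4)) (TangentSpace (𝓡 4) : M → Type _))
    [g.HasLeviCivita] (T : ℝ), 0 < T → g.IsRiemannian →
    ∀ Q : M → ℝ, ContMDiff (𝓡 4) 𝓘(ℝ, ℝ) ∞ Q → ∀ w₀ : M → ℝ, ContMDiff (𝓡 4) 𝓘(ℝ, ℝ) ∞ w₀ →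
      ∃ w : ℝ → M → ℝ,
        ContMDiffOn ((𝓡 4).prod 𝓘(ℝ, ℝ)) 𝓘(ℝ, ℝ) ∞ (fun p : M × ℝ ↦ w p.2 p.1) (univ ×ˢ Icc 0 T) ∧
        w 0 = w₀ ∧
        ∀ s ∈ Icc 0 T, ∀ x : M, HasDerivWithinAt (fun r ↦ w r x)
          (g.dalembertian (w s) x - Q x * w s x) (Icc 0 T) s

/-! ## Registered stubs (sorry ONLY here; signatures spelled over tree declarations, no local names) -/

/-- STUB S (L) — `MaximiserIsShrinker` verbatim with `IsPscMaximiser`/`EntropyFloor` unfolded: a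
Riemannian `g` with Levi-Civita connection and `R > 0` on a closed 4-manifold of the summit binder,
all of whose PSC competitors' entropy floors are floors of `g` (`ν(g) = sup`), satisfies
`Ric + ∇²f = g/(2τ)` for some `τ > 0`, `f` smooth. Why plausibly true: Perelman's monotonicity with
equality case along the short-time flow (docstring of `MaximiserIsShrinker`); triage r1-1/2/3
verified the chain and the small models (`S³ × S¹`: sup `= ν_cyl` not attained, consistent; `ℂP²`
not a local max, consistent). Why hard as a Lean target: (T2) monotonicity, short-time existence,
Rothaus minimisers are absent from the tree. Sources: Perelman2002Entropy §3.1; Topping2006 Ch. 8;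
CaoHamiltonIlmanen2004 §2; Rothaus 1981. -/
theorem stub_maximiserIsShrinker :
    ∀ (M : Type) [TopologicalSpace M] [T2Space M] [SecondCountableTopology M]
      [ChartedSpace (EuclideanSpace ℝ (Fin 4)) M] [IsManifold (𝓡 4) ∞ M] [CompactSpace M] [T3Space M]
      [MeasurableSpace M] [BorelSpace M]
      (g : PseudoRiemannianMetric (𝓡 4) ∞ (EuclideanSpace ℝ (Fin 4)) (TangentSpace (𝓡 4) : M → Type _))
      [g.HasLeviCivita] (hg : g.IsRiemannian),
      ((∀ x : M, 0 < g.scalarCurvature x) ∧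
        ∀ (g₂ : PseudoRiemannianMetric (𝓡 4) ∞ (EuclideanSpace ℝ (Fin 4))
            (TangentSpace (𝓡 4) : M → Type _))
          [g₂.HasLeviCivita] (hg₂ : g₂.IsRiemannian), (∀ x : M, 0 < g₂.scalarCurvature x) →
          ∀ c : ℝ,
            (∀ τ : ℝ, 0 < τ → ∀ f : M → ℝ, ContMDiff (𝓡 4) 𝓘(ℝ, ℝ) ∞ f →
              ∫ x, (4 * Real.pi * τ) ^ (-(4 : ℝ) / 2) * Real.exp (-f x)
                  ∂(riemannianMeasure (g₂.toContMDiffRiemannianMetric hg₂)) = 1 →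
              c ≤ ∫ x, (τ * (g₂.scalarCurvature x + g₂.gradSq f x) + f x - 4) *
                  ((4 * Real.pi * τ) ^ (-(4 : ℝ) / 2) * Real.exp (-f x))
                  ∂(riemannianMeasure (g₂.toContMDiffRiemannianMetric hg₂))) →
            ∀ τ : ℝ, 0 < τ → ∀ f : M → ℝ, ContMDiff (𝓡 4) 𝓘(ℝ, ℝ) ∞ f →
              ∫ x, (4 * Real.pi * τ) ^ (-(4 : ℝ) / 2) * Real.exp (-f x)
                  ∂(riemannianMeasure (g.toContMDiffRiemannianMetric hg)) = 1 →
              c ≤ ∫ x, (τ * (g.scalarCurvature x + g.gradSq f x) + f x - 4) *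
                  ((4 * Real.pi * τ) ^ (-(4 : ℝ) / 2) * Real.exp (-f x))
                  ∂(riemannianMeasure (g.toContMDiffRiemannianMetric hg))) →
      ∃ τ : ℝ, 0 < τ ∧ ∃ f : M → ℝ, ContMDiff (𝓡 4) 𝓘(ℝ, ℝ) ∞ f ∧
        ∀ (x : M) (X Y : TangentSpace (𝓡 4) x),
          g.ricci x X Y + g.hessian f x X Y = (1 / (2 * τ)) * g.val x X Y := by
  sorry

/-- STUB R (OPEN, theorem-shaped; K2-smooth) — `MaximiserRigidity` verbatim with
`IsPscMaximiser`/`EntropyFloor` unfolded: on a closed `M ≃ₕ S⁴`, a gradient shrinking soliton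
`(g, f, τ)` (`Ric + ∇²f = g/(2τ)`, `g` Riemannian with Levi-Civita connection) whose metric is a PSC
`ν`-maximiser, normalised to `Vol = 8π²/3`, has `Ric ≥ 3g` (⇔ isometric to `S⁴(1)` by Bishop) and
`M ≅ S⁴`. Why plausibly true: `b₂ = 0` corner of Hamilton Conj. 1 / Cao Conj. 2; no compact non-round
shrinker with `b₂ = 0` is known; Einstein case = Hitchin–Gursky; second-variation calculus of
CHI 2004 §2 / Cao–Zhu 2012 / Cao–Zhu 2024 Thm 1.1–1.2; Kröncke 2015 (round `S⁴` local max). Why it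
might fail: a `ν`-stable non-Einstein compact shrinker on an exotic (or the standard!) `S⁴` — none
known; on `S⁴` the statement is uniqueness of maximisers, open. Sources: arXiv:math/0404165,
arXiv:1008.0842, arXiv:2304.01453, arXiv:1403.3721, Hitchin1974, Gursky2000. -/
theorem stub_maximiserRigidity :
    ∀ (M : Type) [TopologicalSpace M] [T2Space M] [SecondCountableTopology M]
      [ChartedSpace (EuclideanSpace ℝ (Fin 4)) M] [IsManifold (𝓡 4) ∞ M] [CompactSpace M] [T3Space M]
      [MeasurableSpace M] [BorelSpace M],
      M ≃ₕ Metric.sphere (0 : EuclideanSpace ℝ (Fin 5)) 1 →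
      ∀ (g : PseudoRiemannianMetric (𝓡 4) ∞ (EuclideanSpace ℝ (Fin 4)) (TangentSpace (𝓡 4) : M → Type _))
        [g.HasLeviCivita] (hg : g.IsRiemannian) (f : M → ℝ) (τ : ℝ), 0 < τ →
        ContMDiff (𝓡 4) 𝓘(ℝ, ℝ) ∞ f →
        (∀ (x : M) (X Y : TangentSpace (𝓡 4) x),
          g.ricci x X Y + g.hessian f x X Y = (1 / (2 * τ)) * g.val x X Y) →
        ((∀ x : M, 0 < g.scalarCurvature x) ∧
          ∀ (g₂ : PseudoRiemannianMetric (𝓡 4) ∞ (EuclideanSpace ℝ (Fin 4))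
              (TangentSpace (𝓡 4) : M → Type _))
            [g₂.HasLeviCivita] (hg₂ : g₂.IsRiemannian), (∀ x : M, 0 < g₂.scalarCurvature x) →
            ∀ c : ℝ,
              (∀ τ : ℝ, 0 < τ → ∀ f : M → ℝ, ContMDiff (𝓡 4) 𝓘(ℝ, ℝ) ∞ f →
                ∫ x, (4 * Real.pi * τ) ^ (-(4 : ℝ) / 2) * Real.exp (-f x)
                    ∂(riemannianMeasure (g₂.toContMDiffRiemannianMetric hg₂)) = 1 →
                c ≤ ∫ x, (τ * (g₂.scalarCurvature x + g₂.gradSq f x) + f x - 4) *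
                    ((4 * Real.pi * τ) ^ (-(4 : ℝ) / 2) * Real.exp (-f x))
                    ∂(riemannianMeasure (g₂.toContMDiffRiemannianMetric hg₂))) →
              ∀ τ : ℝ, 0 < τ → ∀ f : M → ℝ, ContMDiff (𝓡 4) 𝓘(ℝ, ℝ) ∞ f →
                ∫ x, (4 * Real.pi * τ) ^ (-(4 : ℝ) / 2) * Real.exp (-f x)
                    ∂(riemannianMeasure (g.toContMDiffRiemannianMetric hg)) = 1 →
                c ≤ ∫ x, (τ * (g.scalarCurvature x + g.gradSq f x) + f x - 4) *
                    ((4 * Real.pi * τ) ^ (-(4 : ℝ) / 2) * Real.exp (-f x))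
                    ∂(riemannianMeasure (g.toContMDiffRiemannianMetric hg))) →
        (riemannianMeasure (g.toContMDiffRiemannianMetric hg) Set.univ).toReal = 8 * Real.pi ^ 2 / 3 →
        (∀ (x : M) (v : TangentSpace (𝓡 4) x), 3 * g.val x v v ≤ g.ricci x v v) ∧
          Nonempty (M ≃ₘ⟮𝓡 4, 𝓡 4⟯ Metric.sphere (0 : EuclideanSpace ℝ (Fin 5)) 1) := by
  sorry

/-- STUB A (OPEN, HARDEST, no literature; K1-output) — `EntropySupAttained` verbatim with
`IsPscMaximiser`/`EntropyFloor` unfolded: for every closed `M ≃ₕ S⁴` there are a closed `N ≃ₕ S⁴`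
and a PSC `ν`-maximiser `g` on `N` with `Vol = 8π²/3` such that for every `ε > 0` some PSC metric `h`
on `M` has every entropy floor of `g` lowered by `ε`. Why plausibly true: it is the output of
concentration-compactness for a flow-monotone functional whose only known losses of compactness in
`{R > 0}` on homotopy spheres — conformal bubbling (penalised: `ν ≤ ν_cyl`), neck-stretching
(`ν → min(pieces, ν_cyl)`), `ℝ⁴/Γ`-bubbles (need `H₂ = 0` Ricci-flat ALE pieces, none known) — all
either cost entropy or hand the sup to a homotopy-sphere PIECE; branch (c) of the docstring of
`EntropySupAttained` needs recognition (S + R of this line, or RUNG). Why it might fail: an exotic `Σ`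
with `ν(Σ) ≤ ν_cyl` whose maximising sequences never settle (infinite neck-stretching or entropy-scale
collapse) — which is itself the structural prediction the card makes about exotica; or, on `S⁴`,
non-attainment of `sup ν` over PSC metrics (contradicting the expected RoundOptimality). Sources:
Perelman2002Entropy §3–4, HaslhoferMuller2011 arXiv:1005.3255 (orbifold compactness of 4-d shrinkers
under entropy/energy bounds), Bamler2020Structure arXiv:2009.03243 §2 (F-limits with entropy floor),
CaoHamiltonIlmanen2004 Thm 3.4, Kroencke arXiv:1403.3721. -/
theorem stub_compactnessModNecks :
    ∀ (M : Type) [TopologicalSpace M] [T2Space M] [SecondCountableTopology M]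
      [ChartedSpace (EuclideanSpace ℝ (Fin 4)) M] [IsManifold (𝓡 4) ∞ M] [CompactSpace M] [T3Space M]
      [MeasurableSpace M] [BorelSpace M],
      M ≃ₕ Metric.sphere (0 : EuclideanSpace ℝ (Fin 5)) 1 →
      ∃ (N : Type) (_ : TopologicalSpace N) (_ : T2Space N) (_ : SecondCountableTopology N)
        (_ : ChartedSpace (EuclideanSpace ℝ (Fin 4)) N) (_ : IsManifold (𝓡 4) ∞ N) (_ : CompactSpace N)
        (_ : T3Space N) (_ : MeasurableSpace N) (_ : BorelSpace N)
        (_ : N ≃ₕ Metric.sphere (0 : EuclideanSpace ℝ (Fin 5)) 1)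
        (g : PseudoRiemannianMetric (𝓡 4) ∞ (EuclideanSpace ℝ (Fin 4)) (TangentSpace (𝓡 4) : N → Type _))
        (_ : g.HasLeviCivita) (hg : g.IsRiemannian),
        ((∀ x : N, 0 < g.scalarCurvature x) ∧
          ∀ (g₂ : PseudoRiemannianMetric (𝓡 4) ∞ (EuclideanSpace ℝ (Fin 4))
              (TangentSpace (𝓡 4) : N → Type _))
            [g₂.HasLeviCivita] (hg₂ : g₂.IsRiemannian), (∀ x : N, 0 < g₂.scalarCurvature x) →
            ∀ c : ℝ,
              (∀ τ : ℝ, 0 < τ → ∀ f : N → ℝ, ContMDiff (𝓡 4) 𝓘(ℝ, ℝ) ∞ f →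
                ∫ x, (4 * Real.pi * τ) ^ (-(4 : ℝ) / 2) * Real.exp (-f x)
                    ∂(riemannianMeasure (g₂.toContMDiffRiemannianMetric hg₂)) = 1 →
                c ≤ ∫ x, (τ * (g₂.scalarCurvature x + g₂.gradSq f x) + f x - 4) *
                    ((4 * Real.pi * τ) ^ (-(4 : ℝ) / 2) * Real.exp (-f x))
                    ∂(riemannianMeasure (g₂.toContMDiffRiemannianMetric hg₂))) →
              ∀ τ : ℝ, 0 < τ → ∀ f : N → ℝ, ContMDiff (𝓡 4) 𝓘(ℝ, ℝ) ∞ f →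
                ∫ x, (4 * Real.pi * τ) ^ (-(4 : ℝ) / 2) * Real.exp (-f x)
                    ∂(riemannianMeasure (g.toContMDiffRiemannianMetric hg)) = 1 →
                c ≤ ∫ x, (τ * (g.scalarCurvature x + g.gradSq f x) + f x - 4) *
                    ((4 * Real.pi * τ) ^ (-(4 : ℝ) / 2) * Real.exp (-f x))
                    ∂(riemannianMeasure (g.toContMDiffRiemannianMetric hg))) ∧
        (riemannianMeasure (g.toContMDiffRiemannianMetric hg) Set.univ).toReal = 8 * Real.pi ^ 2 / 3 ∧
        ∀ ε : ℝ, 0 < ε →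
          ∃ (h : PseudoRiemannianMetric (𝓡 4) ∞ (EuclideanSpace ℝ (Fin 4))
              (TangentSpace (𝓡 4) : M → Type _))
            (_ : h.HasLeviCivita) (hh : h.IsRiemannian),
            (∀ x : M, 0 < h.scalarCurvature x) ∧
              ∀ c : ℝ,
                (∀ τ : ℝ, 0 < τ → ∀ f : N → ℝ, ContMDiff (𝓡 4) 𝓘(ℝ, ℝ) ∞ f →
                  ∫ x, (4 * Real.pi * τ) ^ (-(4 : ℝ) / 2) * Real.exp (-f x)
                      ∂(riemannianMeasure (g.toContMDiffRiemannianMetric hg)) = 1 →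
                  c ≤ ∫ x, (τ * (g.scalarCurvature x + g.gradSq f x) + f x - 4) *
                      ((4 * Real.pi * τ) ^ (-(4 : ℝ) / 2) * Real.exp (-f x))
                      ∂(riemannianMeasure (g.toContMDiffRiemannianMetric hg))) →
                ∀ τ : ℝ, 0 < τ → ∀ f : M → ℝ, ContMDiff (𝓡 4) 𝓘(ℝ, ℝ) ∞ f →
                  ∫ x, (4 * Real.pi * τ) ^ (-(4 : ℝ) / 2) * Real.exp (-f x)
                      ∂(riemannianMeasure (h.toContMDiffRiemannianMetric hh)) = 1 →
                  c - ε ≤ ∫ x, (τ * (h.scalarCurvature x + h.gradSq f x) + f x - 4) *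
                      ((4 * Real.pi * τ) ^ (-(4 : ℝ) / 2) * Real.exp (-f x))
                      ∂(riemannianMeasure (h.toContMDiffRiemannianMetric hh)) := by
  sorry

/-- STUB H (L; library apex SHARED verbatim with line `curvature-dimension-entropy-floor`'s
`stub_staticLinearHeat` and with `carrilloNi_muEntropy_eq_log_shrinkerDensity_of_staticLinearHeat`)
— `StaticLinearHeat`: the static linear heat-type Cauchy problem `∂ₛw = Δ_g w − Q w`, `w(0) = w₀`,
smooth on `M × [0, T]`, on closed connected Riemannian 4-manifolds. Why plausibly true: standard
linear parabolic theory (Friedman 1964 Ch. 1 Thm 10, Ch. 3 Thm 7; Grigor'yan 2009 Thm 7.7–7.10). Why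
hard: the tree has Lions' very-weak existence (`exists_veryWeak_linearHeat`), interior regularity
(`exists_contMDiffOn_ae_eq_of_linearHeat_veryWeak`) and uniqueness (`heatDrift_unique`), not yet
smoothness up to `s = 0`. One proof closes this stub on BOTH lines. -/
theorem stub_staticLinearHeat :
    ∀ (M : Type) [TopologicalSpace M] [T2Space M] [SecondCountableTopology M]
      [ChartedSpace (EuclideanSpace ℝ (Fin 4)) M] [IsManifold (𝓡 4) ∞ M] [CompactSpace M] [T3Space M]
      [MeasurableSpace M] [BorelSpace M] [ConnectedSpace M]
      (g : PseudoRiemannianMetric (𝓡 4) ∞ (EuclideanSpace ℝ (Fin 4)) (TangentSpace (𝓡 4) : M → Type _))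
      [g.HasLeviCivita] (T : ℝ), 0 < T → g.IsRiemannian →
      ∀ Q : M → ℝ, ContMDiff (𝓡 4) 𝓘(ℝ, ℝ) ∞ Q → ∀ w₀ : M → ℝ, ContMDiff (𝓡 4) 𝓘(ℝ, ℝ) ∞ w₀ →
        ∃ w : ℝ → M → ℝ,
          ContMDiffOn ((𝓡 4).prod 𝓘(ℝ, ℝ)) 𝓘(ℝ, ℝ) ∞ (fun p : M × ℝ ↦ w p.2 p.1) (univ ×ˢ Icc 0 T) ∧
          w 0 = w₀ ∧
          ∀ s ∈ Icc 0 T, ∀ x : M, HasDerivWithinAt (fun r ↦ w r x)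
            (g.dalembertian (w s) x - Q x * w s x) (Icc 0 T) s := by
  sorry

/-! ### Consistency: each named statement IS its registered stub (definitionally) -/

theorem maximiserIsShrinker_holds : MaximiserIsShrinker := stub_maximiserIsShrinker
theorem maximiserRigidity_holds : MaximiserRigidity := stub_maximiserRigidity
theorem entropySupAttained_holds : EntropySupAttained := stub_compactnessModNecks
theorem staticLinearHeat_holds : StaticLinearHeat := stub_staticLinearHeat

/-! ### Name-keyed aliases of the four statements (the hypotheses of the composition; the skeleton
audit admits a hypothesis only if its head constant is a registered obligation or is named like a
declared stub) -/
namespace Registered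

/-- Alias of `MaximiserIsShrinker` keyed by the registered stub name. -/
abbrev stub_maximiserIsShrinker : Prop := MaximiserIsShrinker
/-- Alias of `MaximiserRigidity` keyed by the registered stub name. -/
abbrev stub_maximiserRigidity : Prop := MaximiserRigidity
/-- Alias of `EntropySupAttained` keyed by the registered stub name. -/
abbrev stub_compactnessModNecks : Prop := EntropySupAttained
/-- Alias of `StaticLinearHeat` keyed by the registered stub name. -/
abbrev stub_staticLinearHeat : Prop := StaticLinearHeat

end Registered

/-! ## Glue (PROVED) -/

/-- **Entropy floors are downward closed in the constant.** [folklore] -/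
theorem entropyFloor_mono {M : Type} [TopologicalSpace M] [T2Space M] [SecondCountableTopology M]
    [ChartedSpace (EuclideanSpace ℝ (Fin 4)) M] [IsManifold (𝓡 4) ∞ M] [CompactSpace M] [T3Space M]
    [MeasurableSpace M] [BorelSpace M]
    {g : PseudoRiemannianMetric (𝓡 4) ∞ (EuclideanSpace ℝ (Fin 4)) (TangentSpace (𝓡 4) : M → Type _)}
    [g.HasLeviCivita] {hg : g.IsRiemannian} {c c' : ℝ} (hcc' : c' ≤ c)
    (h : EntropyFloor M g hg c) : EntropyFloor M g hg c' :=
  fun τ hτ f hf hn ↦ hcc'.trans (h τ hτ f hf hn)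

/-- **Theorem A of line `curvature-dimension-entropy-floor`, modulo its library apex** — assembled from
the five Theorems files landed by that line's lead (B1 `stub_dimensionalFisher`, B2
`stub_entropyEnergy_alongFlow`, B3a `stub_entropyEnergy_positive`, B3b `stub_entropyEnergy_of_positive`,
C `stub_entropyVolume_of_entropyEnergy`): given `StaticLinearHeat`, on a closed connected Riemannian
4-manifold with `Ric ≥ 3g`, `𝒲(g,f,τ) ≥ log Vol − 2 log(2π/3) − 2` for all `τ > 0` and smooth
compatible `f`. Bakry–Gentil–Ledoux 2014 §6; Bakry–Bolley–Gentil arXiv:1412.5165 (4.1). [folklore] -/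
theorem theoremA_of_staticLinearHeat (hH : StaticLinearHeat)
    (M : Type) [TopologicalSpace M] [T2Space M] [SecondCountableTopology M]
    [ChartedSpace (EuclideanSpace ℝ (Fin 4)) M] [IsManifold (𝓡 4) ∞ M] [CompactSpace M] [T3Space M]
    [MeasurableSpace M] [BorelSpace M] [ConnectedSpace M]
    (g : PseudoRiemannianMetric (𝓡 4) ∞ (EuclideanSpace ℝ (Fin 4)) (TangentSpace (𝓡 4) : M → Type _))
    [g.HasLeviCivita] (hg : g.IsRiemannian)
    (hRic : ∀ (x : M) (v : TangentSpace (𝓡 4) x), 3 * g.val x v v ≤ g.ricci x v v)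
    {τ : ℝ} (hτ : 0 < τ) {f : M → ℝ} (hf : ContMDiff (𝓡 4) 𝓘(ℝ, ℝ) ∞ f)
    (hnorm : ∫ x, (4 * Real.pi * τ) ^ (-(4 : ℝ) / 2) * Real.exp (-f x)
      ∂(riemannianMeasure (g.toContMDiffRiemannianMetric hg)) = 1) :
    Real.log ((riemannianMeasure (g.toContMDiffRiemannianMetric hg) Set.univ).toReal)
        - 2 * Real.log (2 * Real.pi / 3) - 2 ≤
      ∫ x, (τ * (g.scalarCurvature x + g.gradSq f x) + f x - 4) *
        ((4 * Real.pi * τ) ^ (-(4 : ℝ) / 2) * Real.exp (-f x))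
        ∂(riemannianMeasure (g.toContMDiffRiemannianMetric hg)) :=
  _root_.Summit.SmoothPoincare4.SmoothPoincare4.Theorems.stub_entropyVolume_of_entropyEnergy
    (_root_.Summit.SmoothPoincare4.SmoothPoincare4.Theorems.stub_entropyEnergy_of_positive
      (_root_.Summit.SmoothPoincare4.SmoothPoincare4.Theorems.stub_entropyEnergy_positive
        (_root_.Summit.SmoothPoincare4.SmoothPoincare4.Theorems.stub_entropyEnergy_alongFlow
          _root_.Summit.SmoothPoincare4.SmoothPoincare4.Theorems.stub_dimensionalFisher)
        hH))
    M g hg hRic τ hτ f hf hnorm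

/-- **RoundBound, modulo the shared apex.** `Ric ≥ 3g` and `Vol = 8π²/3 = Vol S⁴(1)` (by Bishop,
exactly the unit round sphere — in particular the output of Statement R) give the entropy floor
`log 6 − 2 = ν(S⁴_rd)` at EVERY scale: `log(8π²/3) − 2 log(2π/3) − 2 = log 6 − 2`. No Perelman
monotonicity, no ancient flow. [folklore] -/
theorem roundBound_of_staticLinearHeat (hH : StaticLinearHeat)
    (M : Type) [TopologicalSpace M] [T2Space M] [SecondCountableTopology M]
    [ChartedSpace (EuclideanSpace ℝ (Fin 4)) M] [IsManifold (𝓡 4) ∞ M] [CompactSpace M] [T3Space M]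
    [MeasurableSpace M] [BorelSpace M] [ConnectedSpace M]
    (g : PseudoRiemannianMetric (𝓡 4) ∞ (EuclideanSpace ℝ (Fin 4)) (TangentSpace (𝓡 4) : M → Type _))
    [g.HasLeviCivita] (hg : g.IsRiemannian)
    (hRic : ∀ (x : M) (v : TangentSpace (𝓡 4) x), 3 * g.val x v v ≤ g.ricci x v v)
    (hVol : (riemannianMeasure (g.toContMDiffRiemannianMetric hg) Set.univ).toReal
      = 8 * Real.pi ^ 2 / 3) :
    EntropyFloor M g hg (Real.log 6 - 2) := by
  intro τ hτ f hf hnorm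
  have hW := theoremA_of_staticLinearHeat hH M g hg hRic hτ hf hnorm
  rw [hVol] at hW
  have hπ : 0 < Real.pi := Real.pi_pos
  have h8 : Real.log 8 = 3 * Real.log 2 := by
    rw [show (8 : ℝ) = 2 ^ 3 by norm_num, Real.log_pow]
    push_cast
    ring
  have hB : Real.log (8 * Real.pi ^ 2 / 3) = 3 * Real.log 2 + 2 * Real.log Real.pi - Real.log 3 := by
    rw [Real.log_div (by positivity) (by norm_num), Real.log_mul (by norm_num) (by positivity),
      Real.log_pow, h8]
    push_cast
    ring
  have h2 : Real.log (2 * Real.pi / 3) = Real.log 2 + Real.log Real.pi - Real.log 3 := by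
    rw [Real.log_div (by positivity) (by norm_num), Real.log_mul (by norm_num) hπ.ne']
  have h6 : Real.log 6 = Real.log 2 + Real.log 3 := by
    rw [show (6 : ℝ) = 2 * 3 by norm_num, Real.log_mul (by norm_num) (by norm_num)]
  rw [hB, h2] at hW
  rw [h6]
  linarith

/-- **The line's `δ`**: `ε = (ν_rd − ν_cyl)/2 > 0` (Window.lean `nuCyl_lt_nuRound`), and
`0.013 < ε < 0.01315` (`margin_gt`, `margin_lt`). [folklore] -/
theorem halfMargin_pos :
    (0 : ℝ) < ((Real.log 6 - 2) - (Real.log 2 + Real.log Real.pi / 2 - 3 / 2)) / 2 := by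
  have h := Summit.SmoothPoincare4.Cruxes.SubcylindricalExistence.Negative.nuCyl_lt_nuRound
  linarith

theorem halfMargin_bounds :
    (0.013 : ℝ) < ((Real.log 6 - 2) - (Real.log 2 + Real.log Real.pi / 2 - 3 / 2)) / 2 ∧
      ((Real.log 6 - 2) - (Real.log 2 + Real.log Real.pi / 2 - 3 / 2)) / 2 < 0.01315 := by
  have h₁ := Summit.SmoothPoincare4.Cruxes.SubcylindricalExistence.Negative.margin_gt
  have h₂ := Summit.SmoothPoincare4.Cruxes.SubcylindricalExistence.Negative.margin_lt
  constructor <;> linarith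

/-! ## The composition: the four stubs imply the crux, by name -/

/-- **ENT from the line.** `SubcylindricalExistence` (stmt-SmoothPoincare4-10871) from the four
registered stubs (pure logic + the proved glue; no `sorry`): for `M ≃ₕ S⁴`, STUB A yields a homotopy
4-sphere `N` (connected: `pathConnectedSpace_of_homotopyEquiv`) with a normalised PSC `ν`-maximiser
`g`; STUB S makes `g` a gradient shrinker; STUB R gives `Ric ≥ 3g`; RoundBound (STUB H through the
landed Theorem A chain) gives the floor `log 6 − 2` for `g`; A's approximation clause with
`ε = (ν_rd − ν_cyl)/2` hands the floor `log 6 − 2 − ε = ν_cyl + ε` to a PSC metric `h` on `M`: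
ENT with `δ = ε`. -/
theorem SubcylindricalExistence_of (hS : Registered.stub_maximiserIsShrinker)
    (hR : Registered.stub_maximiserRigidity) (hA : Registered.stub_compactnessModNecks)
    (hH : Registered.stub_staticLinearHeat) :
    _root_.Summit.SmoothPoincare4.SmoothPoincare4.Theses.EntropyRung.SubcylindricalExistence := by
  intro M _ _ _ _ _ _ _ _ _ e
  -- STUB A: an attained level below `ν(M)` on some homotopy 4-sphere `N`
  obtain ⟨N, _, _, _, _, _, _, _, _, _, eN, g, hLC, hg, hMax, hVol, hApprox⟩ := hA M e
  -- `N ≃ₕ S⁴` ⇒ `N` (path) connected: RoundBound carries `[ConnectedSpace N]` (load-bearing)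
  haveI : PathConnectedSpace (Metric.sphere (0 : EuclideanSpace ℝ (Fin 5)) 1) :=
    Literature.Topology.FourManifolds.pathConnectedSpace_sphere_four
  haveI : PathConnectedSpace N :=
    Literature.Topology.FourManifolds.pathConnectedSpace_of_homotopyEquiv eN
  -- STUB S: the maximiser is a gradient shrinking soliton
  obtain ⟨τ, hτ, f, hf, hsol⟩ := hS N g hg hMax
  -- STUB R: hence round — `Ric ≥ 3g` at `Vol = 8π²/3`
  obtain ⟨hRic, -⟩ := hR N eN g hg f τ hτ hf hsol hMax hVol
  -- RoundBound from STUB H: `ν(g) ≥ log 6 − 2`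
  have hFloor : EntropyFloor N g hg (Real.log 6 - 2) := roundBound_of_staticLinearHeat hH N g hg hRic hVol
  -- transport the floor, lowered by `ε = (ν_rd − ν_cyl)/2`, to a PSC metric on `M`
  obtain ⟨h, hLCh, hh, hRh, hpull⟩ := hApprox _ halfMargin_pos
  refine ⟨h, hLCh, hh, hRh, _, halfMargin_pos, fun τ' hτ' f' hf' hn' ↦ ?_⟩
  have hW := hpull (Real.log 6 - 2) hFloor τ' hτ' f' hf' hn'
  linarith

/-- Wiring check: the registered stubs feed `SubcylindricalExistence_of` as stated. -/
example : _root_.Summit.SmoothPoincare4.SmoothPoincare4.Theses.EntropyRung.SubcylindricalExistence :=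
  SubcylindricalExistence_of stub_maximiserIsShrinker stub_maximiserRigidity stub_compactnessModNecks
    stub_staticLinearHeat

/-! ## Scratch checks against the landed `Negative/*` lemmas -/

/-- ENT is SPC4-hard modulo the rung (Logic.lean): all of that hardness sits in STUBS R and A. -/
example (hRung : _root_.Summit.SmoothPoincare4.SmoothPoincare4.Theses.EntropyRung.SubcylindricalRecognition)
    (h : ¬ _root_.SmoothPoincare4) :
    ¬ _root_.Summit.SmoothPoincare4.SmoothPoincare4.Theses.EntropyRung.SubcylindricalExistence :=
  Summit.SmoothPoincare4.Cruxes.SubcylindricalExistence.Negative.not_subcylindricalExistence_of_not_spc4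
    hRung h

/-- The window (Window.lean): `0.026 < ν_rd − ν_cyl < 0.0263`; the line's `δ` is half of it. -/
example : (0.026 : ℝ) < (Real.log 6 - 2) - (Real.log 2 + Real.log Real.pi / 2 - 3 / 2) ∧
    (Real.log 6 - 2) - (Real.log 2 + Real.log Real.pi / 2 - 3 / 2) < 0.0263 :=
  ⟨Summit.SmoothPoincare4.Cruxes.SubcylindricalExistence.Negative.margin_gt,
    Summit.SmoothPoincare4.Cruxes.SubcylindricalExistence.Negative.margin_lt⟩

/-- Necks and bubble sheets sit at/below the cylinder (Window.lean) — the degenerations Statement A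
quotients out. -/
example : (Real.log 2 - 1) < (Real.log 2 + Real.log Real.pi / 2 - 3 / 2) :=
  Summit.SmoothPoincare4.Cruxes.SubcylindricalExistence.Negative.nuSheet_lt_nuCyl

/-- `Leans on` of the glue resolve: compactness of homotopy 4-spheres is a tree theorem. -/
example (M : Type) [TopologicalSpace M] [T2Space M] [SecondCountableTopology M]
    [ChartedSpace (EuclideanSpace ℝ (Fin 4)) M] [IsManifold (𝓡 4) ∞ M]
    (e : M ≃ₕ Metric.sphere (0 : EuclideanSpace ℝ (Fin 5)) 1) : CompactSpace M :=
  Literature.Topology.FourManifolds.compactSpace_of_homotopyEquiv_sphere_four_holds M e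

end Summit.SmoothPoincare4.SmoothPoincare4.Cruxes.SubcylindricalExistence.EkelandStableShrinker

end
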